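import Summits.MatrixMultiplication.MatrixMultiplication.Theses.FourierTwoFamiliesModP

/-!
# Load-bearing hypotheses of `PrimeDensityDecay`

Crux `FourierTwoFamiliesModP.PrimeDensityDecay` (stmt-MatrixMultiplication-14311), refuter / crux-disprover lane
(`Theorems/PrimeDensityDecay/Negative/`).  Each hypothesis of the crux is necessary: (W) (`primeDensityDecay_false_without_W`, and even weakened to `s² ≤ p`: `primeDensityDecay_false_without_W'`), (X) (`primeDensityDecay_false_without_X`), `p.Prime` (`primeDensityDecay_false_without_prime`, through the junk modulus `p = 0` only).
These are the landed copies of the sections of the standing disproof work file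
`Cruxes/PrimeDensityDecay/Disproof.lean` (same statements and proofs, namespace `…Negative.Disproof`); no theorem here
asserts a Theses decl positively.
-/

namespace Summit.MatrixMultiplication.MatrixMultiplication.Theorems.PrimeDensityDecay.Negative.Disproof

open Finset
open Summit.MatrixMultiplication.MatrixMultiplication.Theses.FourierTwoFamiliesModP

/-! ## 0. Read-back of the crux (the body, verbatim) -/

/-- Read-back: the crux unfolds, by `Iff.rfl`, to the verbatim body below. -/
theorem crux_iff : PrimeDensityDecay ↔
    (∀ ε : ℝ, 0 < ε → ∃ s₀ : ℕ, ∀ p : ℕ, p.Prime → ∀ (n s : ℕ) (A B : Fin n → Finset (ZMod p)), s₀ ≤ s →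
      (∀ i : Fin n, (A i).card = s ∧ (B i).card = s) →
      (∀ i : Fin n, ∀ a ∈ A i, ∀ a' ∈ A i, ∀ b ∈ B i, ∀ b' ∈ B i, (a - a') + (b - b') = 0 → a = a' ∧ b = b') →
      (∀ i j k : Fin n, ∀ a ∈ A i, ∀ a' ∈ A j, ∀ b ∈ B j, ∀ b' ∈ B k, (a - a') + (b - b') = 0 → i = k) →
      (n : ℝ) * (s : ℝ) ≤ ε * (p : ℝ)) := Iff.rfl

/-! ## 1. The standard witness pair: `A = {0,…,s-1}`, `B = {0, s, 2s, …, (s-1)s}` -/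

/-- `{0, 1, …, s-1}` cast into `ZMod p`. -/
def ivA (p s : ℕ) : Finset (ZMod p) := (Finset.range s).image (fun j : ℕ => (j : ZMod p))

/-- `{0, s, 2s, …, (s-1)s}` cast into `ZMod p`. -/
def ivB (p s : ℕ) : Finset (ZMod p) := (Finset.range s).image (fun j : ℕ => ((s * j : ℕ) : ZMod p))

/-- No wrap-around below `s*s`: holds for `p = 0` (`ZMod 0 = ℤ`) and for every `p ≥ s*s`. -/
def NoWrap (p s : ℕ) : Prop := ∀ m : ℕ, m < s * s → m % p = m

/-- `ZMod 0 = ℤ`: no wrap-around at all. -/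
lemma noWrap_zero (s : ℕ) : NoWrap 0 s := fun m _ => Nat.mod_zero m

/-- No wrap-around below `s*s` once `s*s ≤ p`. -/
lemma noWrap_of_le {p s : ℕ} (h : s * s ≤ p) : NoWrap p s :=
  fun _ hm => Nat.mod_eq_of_lt (lt_of_lt_of_le hm h)

/-- `j < s ⇒ j < s*s`. -/
lemma lt_sq_of_lt {s j : ℕ} (hj : j < s) : j < s * s := lt_of_lt_of_le hj (Nat.le_mul_self s)

/-- `j < s ⇒ s*j < s*s`. -/
lemma mul_lt_sq_of_lt {s j : ℕ} (hj : j < s) : s * j < s * s :=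
  Nat.mul_lt_mul_of_pos_left hj (Nat.zero_lt_of_lt hj)

/-- `j, l < s ⇒ j + s*l < s*s` (a two-digit number in base `s`). -/
lemma add_mul_lt_sq {s j l : ℕ} (hj : j < s) (hl : l < s) : j + s * l < s * s := by
  have h1 : j + s * l < s + s * l := Nat.add_lt_add_right hj _
  have h2 : s + s * l = s * (l + 1) := by ring
  have h3 : s * (l + 1) ≤ s * s := Nat.mul_le_mul_left s hl
  omega

/-- `|ivA p s| = s` when there is no wrap-around. -/
lemma card_ivA {p s : ℕ} (hp : NoWrap p s) : (ivA p s).card = s := by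
  classical
  rw [ivA, Finset.card_image_of_injOn, Finset.card_range]
  intro j₁ hj₁ j₂ hj₂ h
  simp only [Finset.coe_range, Set.mem_Iio] at hj₁ hj₂
  have h' := (ZMod.natCast_eq_natCast_iff' _ _ _).mp h
  rwa [hp _ (lt_sq_of_lt hj₁), hp _ (lt_sq_of_lt hj₂)] at h'

/-- `|ivB p s| = s` when there is no wrap-around. -/
lemma card_ivB {p s : ℕ} (hp : NoWrap p s) : (ivB p s).card = s := by
  classical
  rw [ivB, Finset.card_image_of_injOn, Finset.card_range]
  intro j₁ hj₁ j₂ hj₂ h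
  simp only [Finset.coe_range, Set.mem_Iio] at hj₁ hj₂
  have h' := (ZMod.natCast_eq_natCast_iff' _ _ _).mp h
  rw [hp _ (mul_lt_sq_of_lt hj₁), hp _ (mul_lt_sq_of_lt hj₂)] at h'
  exact Nat.eq_of_mul_eq_mul_left (Nat.zero_lt_of_lt hj₁) h'

/-- (W) for the witness pair: `{0..s-1} ⊕ s·{0..s-1}` is direct (Euclidean division). -/
lemma iv_W {p s : ℕ} (hp : NoWrap p s) :
    ∀ a ∈ ivA p s, ∀ a' ∈ ivA p s, ∀ b ∈ ivB p s, ∀ b' ∈ ivB p s,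
      (a - a') + (b - b') = 0 → a = a' ∧ b = b' := by
  intro a ha a' ha' b hb b' hb' h
  simp only [ivA, ivB, Finset.mem_image, Finset.mem_range] at ha ha' hb hb'
  obtain ⟨j₁, hj₁, rfl⟩ := ha
  obtain ⟨j₂, hj₂, rfl⟩ := ha'
  obtain ⟨j₃, hj₃, rfl⟩ := hb
  obtain ⟨j₄, hj₄, rfl⟩ := hb'
  have h' : ((j₁ + s * j₃ : ℕ) : ZMod p) = ((j₂ + s * j₄ : ℕ) : ZMod p) := by
    push_cast at h ⊢
    linear_combination h
  have h'' := (ZMod.natCast_eq_natCast_iff' _ _ _).mp h'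
  rw [hp _ (add_mul_lt_sq hj₁ hj₃), hp _ (add_mul_lt_sq hj₂ hj₄)] at h''
  have hs : 0 < s := Nat.zero_lt_of_lt hj₁
  have hmod := congrArg (· % s) h''
  simp only [Nat.add_mul_mod_self_left, Nat.mod_eq_of_lt hj₁, Nat.mod_eq_of_lt hj₂] at hmod
  subst hmod
  have h34 : j₃ = j₄ := Nat.eq_of_mul_eq_mul_left hs (by omega)
  subst h34
  exact ⟨rfl, rfl⟩

/-! ## (a) Load-bearing hypotheses -/

/-- The crux with hypothesis (W) deleted (verbatim otherwise). -/
def PrimeDensityDecayWithoutW : Prop :=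
  ∀ ε : ℝ, 0 < ε → ∃ s₀ : ℕ, ∀ p : ℕ, p.Prime → ∀ (n s : ℕ) (A B : Fin n → Finset (ZMod p)), s₀ ≤ s →
    (∀ i : Fin n, (A i).card = s ∧ (B i).card = s) →
    (∀ i j k : Fin n, ∀ a ∈ A i, ∀ a' ∈ A j, ∀ b ∈ B j, ∀ b' ∈ B k, (a - a') + (b - b') = 0 → i = k) →
    (n : ℝ) * (s : ℝ) ≤ ε * (p : ℝ)

/-- ANY PROOF MUST USE (W).  Without directness nothing bounds `s`: one block `A = B = ℤ/p`
(`n = 1`, `s = p`) satisfies (X) vacuously and has density 1.  (The finer role of (W) — beyond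
forcing `s² ≤ p` — is the `exclusion zone` `Y ∩ (B_i + (A_i − A_i) ∖ 0) = ∅`; even with `s² ≤ p`
imposed, the (X)-only family `A_i = B_i = {i, i+q, …, i+(s-1)q}`, `i < q`, `p ∈ (2qs, 4qs]` keeps
density `≥ 1/4` at every `s` — not yet formalised here.) -/
theorem primeDensityDecay_false_without_W : ¬ PrimeDensityDecayWithoutW := by
  intro h
  obtain ⟨s₀, hs₀⟩ := h (1 / 2) (by norm_num)
  obtain ⟨p, hp_ge, hp⟩ := Nat.exists_infinite_primes (s₀ + 2)
  haveI : NeZero p := ⟨hp.ne_zero⟩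
  have key := hs₀ p hp 1 p (fun _ => Finset.univ) (fun _ => Finset.univ) (by omega)
    (fun _ => by simp [Finset.card_univ, ZMod.card])
    (fun i j k _ _ _ _ _ _ _ _ _ => Subsingleton.elim i k)
  have hpos : (0 : ℝ) < p := by exact_mod_cast hp.pos
  push_cast at key
  linarith

/-- The crux with hypothesis (X) deleted (verbatim otherwise). -/
def PrimeDensityDecayWithoutX : Prop :=
  ∀ ε : ℝ, 0 < ε → ∃ s₀ : ℕ, ∀ p : ℕ, p.Prime → ∀ (n s : ℕ) (A B : Fin n → Finset (ZMod p)), s₀ ≤ s →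
    (∀ i : Fin n, (A i).card = s ∧ (B i).card = s) →
    (∀ i : Fin n, ∀ a ∈ A i, ∀ a' ∈ A i, ∀ b ∈ B i, ∀ b' ∈ B i, (a - a') + (b - b') = 0 → a = a' ∧ b = b') →
    (n : ℝ) * (s : ℝ) ≤ ε * (p : ℝ)

/-- ANY PROOF MUST USE (X).  Without the cross condition the blocks need not even be disjoint:
`n = p` copies of the single direct pair `({0..s-1}, s·{0..s-1})`, `p ≥ s²`, give `n·s = p·s`. -/
theorem primeDensityDecay_false_without_X : ¬ PrimeDensityDecayWithoutX := by
  intro h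
  obtain ⟨s₀, hs₀⟩ := h (1 / 2) (by norm_num)
  obtain ⟨p, hp_ge, hp⟩ := Nat.exists_infinite_primes ((s₀ + 1) * (s₀ + 1))
  have hnw : NoWrap p (s₀ + 1) := noWrap_of_le hp_ge
  have key := hs₀ p hp p (s₀ + 1) (fun _ => ivA p (s₀ + 1)) (fun _ => ivB p (s₀ + 1)) (by omega)
    (fun _ => ⟨card_ivA hnw, card_ivB hnw⟩) (fun _ => iv_W hnw)
  have hp1 : (1 : ℝ) ≤ p := by exact_mod_cast hp.one_lt.le
  have hs1 : (1 : ℝ) ≤ ((s₀ + 1 : ℕ) : ℝ) := by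
    push_cast; linarith [(Nat.cast_nonneg s₀ : (0:ℝ) ≤ s₀)]
  nlinarith

/-- The crux with hypothesis `p.Prime` deleted (verbatim otherwise). -/
def PrimeDensityDecayWithoutPrime : Prop :=
  ∀ ε : ℝ, 0 < ε → ∃ s₀ : ℕ, ∀ p : ℕ, ∀ (n s : ℕ) (A B : Fin n → Finset (ZMod p)), s₀ ≤ s →
    (∀ i : Fin n, (A i).card = s ∧ (B i).card = s) →
    (∀ i : Fin n, ∀ a ∈ A i, ∀ a' ∈ A i, ∀ b ∈ B i, ∀ b' ∈ B i, (a - a') + (b - b') = 0 → a = a' ∧ b = b') →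
    (∀ i j k : Fin n, ∀ a ∈ A i, ∀ a' ∈ A j, ∀ b ∈ B j, ∀ b' ∈ B k, (a - a') + (b - b') = 0 → i = k) →
    (n : ℝ) * (s : ℝ) ≤ ε * (p : ℝ)

/-- `p.Prime` IS USED, but only to exclude the junk modulus `p = 0` (`ZMod 0 = ℤ`, where one direct
pair of any size has `n·s = s > ε·0`).  Remark (not formalised): for composite `p ≥ 2` the statement is
implied by the prime case up to `ε ↦ 4ε` (view a design in `ℤ/N` inside `[0,N) ⊂ ℤ`, then in `ℤ/p'`
for a prime `p' ∈ (2N, 4N]`; four-term sums of absolute value `< 2N < p'` vanish mod `p'` iff they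
vanish in `ℤ`, and then they vanish mod `N`). -/
theorem primeDensityDecay_false_without_prime : ¬ PrimeDensityDecayWithoutPrime := by
  intro h
  obtain ⟨s₀, hs₀⟩ := h (1 / 2) (by norm_num)
  have hnw : NoWrap 0 (s₀ + 1) := noWrap_zero _
  have key := hs₀ 0 1 (s₀ + 1) (fun _ => ivA 0 (s₀ + 1)) (fun _ => ivB 0 (s₀ + 1)) (by omega)
    (fun _ => ⟨card_ivA hnw, card_ivB hnw⟩) (fun _ => iv_W hnw)
    (fun i j k _ _ _ _ _ _ _ _ _ => Subsingleton.elim i k)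
  have hs1 : (1 : ℝ) ≤ ((s₀ + 1 : ℕ) : ℝ) := by
    push_cast; linarith [(Nat.cast_nonneg s₀ : (0:ℝ) ≤ s₀)]
  push_cast at key hs1
  linarith

/-! ### (a') The finer role of (W): with (X) and `s² ≤ p` but no directness, density `1/4` persists -/

/-- The interleaved progressions `C_i = {i, i+q, …, i+(s-1)q}` cast into `ZMod p`. -/
def ivC (p q s i : ℕ) : Finset (ZMod p) := (Finset.range s).image (fun j : ℕ => ((i + q * j : ℕ) : ZMod p))

/-- `i + q*j < q*s` for `i < q`, `j < s`. -/
lemma add_mul_lt_mul {q s i j : ℕ} (hi : i < q) (hj : j < s) : i + q * j < q * s := by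
  have h1 : i + q * j < q + q * j := Nat.add_lt_add_right hi _
  have h2 : q + q * j = q * (j + 1) := by ring
  have h3 : q * (j + 1) ≤ q * s := Nat.mul_le_mul_left q hj
  omega

/-- `|C_i| = s` when `q*s ≤ p` (or `p = 0`). -/
lemma card_ivC {p q s i : ℕ} (hp : ∀ m : ℕ, m < 2 * (q * s) → m % p = m) (hi : i < q) :
    (ivC p q s i).card = s := by
  classical
  rw [ivC, Finset.card_image_of_injOn, Finset.card_range]
  intro j₁ hj₁ j₂ hj₂ h
  simp only [Finset.coe_range, Set.mem_Iio] at hj₁ hj₂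
  have h' := (ZMod.natCast_eq_natCast_iff' _ _ _).mp h
  have b₁ := add_mul_lt_mul hi hj₁
  have b₂ := add_mul_lt_mul hi hj₂
  rw [hp _ (by omega), hp _ (by omega)] at h'
  have hq : 0 < q := Nat.zero_lt_of_lt hi
  exact Nat.eq_of_mul_eq_mul_left hq (by omega)

/-- (X) for the interleaved family `A_i = B_i = C_i`, `i < q`: a four-term relation of naturals
`< 2qs ≤ p` is an identity in `ℕ`, and reducing it mod `q` gives `i = k`.  (W) FAILS for it
(`C_i − C_i` repeats every difference `s`-fold), which is the point. -/
lemma ivC_X {p q s : ℕ} (hp : ∀ m : ℕ, m < 2 * (q * s) → m % p = m) :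
    ∀ i j k : Fin q, ∀ a ∈ ivC p q s i, ∀ a' ∈ ivC p q s j, ∀ b ∈ ivC p q s j, ∀ b' ∈ ivC p q s k,
      (a - a') + (b - b') = 0 → i = k := by
  intro i j k a ha a' ha' b hb b' hb' h
  simp only [ivC, Finset.mem_image, Finset.mem_range] at ha ha' hb hb'
  obtain ⟨j₁, hj₁, rfl⟩ := ha
  obtain ⟨j₂, hj₂, rfl⟩ := ha'
  obtain ⟨j₃, hj₃, rfl⟩ := hb
  obtain ⟨j₄, hj₄, rfl⟩ := hb'
  have h' : (((i : ℕ) + q * j₁ + ((j : ℕ) + q * j₃) : ℕ) : ZMod p)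
      = ((((j : ℕ) + q * j₂) + ((k : ℕ) + q * j₄) : ℕ) : ZMod p) := by
    push_cast at h ⊢
    linear_combination h
  have h'' := (ZMod.natCast_eq_natCast_iff' _ _ _).mp h'
  have b₁ := add_mul_lt_mul i.isLt hj₁
  have b₂ := add_mul_lt_mul j.isLt hj₂
  have b₃ := add_mul_lt_mul j.isLt hj₃
  have b₄ := add_mul_lt_mul k.isLt hj₄
  rw [hp _ (by omega), hp _ (by omega)] at h''
  -- h'' : i + q*j₁ + (j + q*j₃) = j + q*j₂ + (k + q*j₄) in ℕ; reduce mod q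
  have hmod := congrArg (· % q) h''
  have e1 : ((i : ℕ) + q * j₁ + ((j : ℕ) + q * j₃)) % q = ((i : ℕ) + (j : ℕ)) % q := by
    rw [show (i : ℕ) + q * j₁ + ((j : ℕ) + q * j₃) = ((i : ℕ) + (j : ℕ)) + q * (j₁ + j₃) by ring]
    exact Nat.add_mul_mod_self_left _ _ _
  have e2 : ((j : ℕ) + q * j₂ + ((k : ℕ) + q * j₄)) % q = ((k : ℕ) + (j : ℕ)) % q := by
    rw [show (j : ℕ) + q * j₂ + ((k : ℕ) + q * j₄) = ((k : ℕ) + (j : ℕ)) + q * (j₂ + j₄) by ring]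
    exact Nat.add_mul_mod_self_left _ _ _
  simp only [e1, e2] at hmod
  -- (i + j) % q = (k + j) % q with i, k < q
  have hik : (i : ℕ) % q = (k : ℕ) % q := by
    have := Nat.ModEq.add_right_cancel' (j : ℕ) (show (i : ℕ) + j ≡ (k : ℕ) + j [MOD q] from hmod)
    exact this
  rw [Nat.mod_eq_of_lt i.isLt, Nat.mod_eq_of_lt k.isLt] at hik
  exact Fin.ext hik

/-- The crux with (W) REPLACED by its cheap consequence `s*s ≤ p` (verbatim otherwise). -/
def PrimeDensityDecayWithoutW' : Prop :=
  ∀ ε : ℝ, 0 < ε → ∃ s₀ : ℕ, ∀ p : ℕ, p.Prime → ∀ (n s : ℕ) (A B : Fin n → Finset (ZMod p)), s₀ ≤ s →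
    s * s ≤ p →
    (∀ i : Fin n, (A i).card = s ∧ (B i).card = s) →
    (∀ i j k : Fin n, ∀ a ∈ A i, ∀ a' ∈ A j, ∀ b ∈ B j, ∀ b' ∈ B k, (a - a') + (b - b') = 0 → i = k) →
    (n : ℝ) * (s : ℝ) ≤ ε * (p : ℝ)

/-- (W) IS USED BEYOND `s² ≤ p`: the interleaved family `A_i = B_i = {i, i+s, …, i+(s-1)s}`,
`i < s`, in `ℤ/p` for a prime `p ∈ (2s², 4s²]` (Bertrand) satisfies (X), balance and `s² ≤ p`,
with `n·s = s² ≥ p/4` at every `s` — so the directness of each pair (the exclusion zones it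
creates, `exclusion_zone`) is what any proof must exploit in the regime `n ≫ s`… here `n = s`,
and taking `q = K·s` classes instead of `s` gives the same density `1/4` with `n = K s` for any `K`
(not formalised: only the parameter choice changes). -/
theorem primeDensityDecay_false_without_W' : ¬ PrimeDensityDecayWithoutW' := by
  intro h
  obtain ⟨s₀, hs₀⟩ := h (1 / 5) (by norm_num)
  set s : ℕ := s₀ + 1 with hsdef
  have hs : 0 < s := Nat.succ_pos _
  have hss : 0 < 2 * (s * s) := by positivity
  obtain ⟨p, hp, hlt, hle⟩ := Nat.exists_prime_lt_and_le_two_mul (2 * (s * s)) (by omega)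
  have hnw : ∀ m : ℕ, m < 2 * (s * s) → m % p = m := fun m hm => Nat.mod_eq_of_lt (by omega)
  have key := hs₀ p hp s s (fun i => ivC p s s i) (fun i => ivC p s s i) (by omega) (by omega)
    (fun i => ⟨card_ivC hnw i.isLt, card_ivC hnw i.isLt⟩) (ivC_X hnw)
  -- key : (s:ℝ) * s ≤ 1/5 * p, while p ≤ 4 s², p > 0
  have hle' : (p : ℝ) ≤ 2 * (2 * ((s : ℝ) * s)) := by exact_mod_cast hle
  have hsR : (1 : ℝ) ≤ s := by
    rw [hsdef]; push_cast; linarith [(Nat.cast_nonneg s₀ : (0:ℝ) ≤ s₀)]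
  nlinarith


end Summit.MatrixMultiplication.MatrixMultiplication.Theorems.PrimeDensityDecay.Negative.Disproof
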